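import Literature.NumberTheory.GelbartRogawski1991.UnitaryDualPairThetaKernel
import Literature.NumberTheory.GelbartRogawski1991.CompatibleSplittingTwist
import Literature.NumberTheory.Weil1964.AdelicMetaplecticScalarTwist
import HarnessLib

-- buildfix G11b-3 recipe (LEDGER B13-1/B13-3): elaborate sequentially so the trailing `attribute [implicit_reducible]`
-- block (reducibilityCoreExt is keyed to the async environment branch) is in force at `.olean` export.
set_option Elab.async false

/-!
# The unitary dual-pair theta kernel under a normalisation `s ↦ s ⊗ η` of the splitting

For a splitting `s : U(J_V ⊗ J_W)(𝔸) →* Mp_ψ(𝕎_𝔸)ᶜᵒⁿᵗ` and a character `η` of the same group, the normalised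
splitting `s ⊗ η := Weil1964.adelicMpCont.twist s η` has

* pair splitting `(s ⊗ η)_pair = s_pair ⊗ (η ∘ pairMap)` (`pairSplitting_twist_apply`);
* Weil representation `ω_ψ ∘ (s ⊗ η)_pair = (η ∘ pairMap) · (ω_ψ ∘ s_pair)` (`pairRep_twist_apply`, `rfl`);
* and is again COMPATIBLE in the sense of [GelbartRogawski1991, Prop. 3.1.1] as soon as `s` is and `η` is trivial
  on the rational points (`isCompatible_twist`, from `SplittingDatum.IsCompatible.of_central_twist` — the "if"
  direction of the Remark p. 457).

Hence every kernel statement of `UnitaryDualPairThetaKernel` keyed to `IsCompatible s` (`proj_pairSplitting`,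
`pairRep_toHomUnits_mem_thetaStabilizer`, `thetaKernelDatum`, …) applies verbatim to `s ⊗ η`.  Kernel only; 0 records.
-/

noncomputable section

open scoped Matrix Kronecker
open NumberField
open Literature.NumberTheory.Automorphic
open Literature.NumberTheory.Weil1964

namespace Literature.NumberTheory.GelbartRogawski1991

namespace UnitaryDualPair

variable (F E : Type) [Field F] [NumberField F] [Field E] [NumberField E] [Algebra F E]
variable (c : E ≃ₐ[F] E) (N M : ℕ) {n : ℕ} (e : Fin N × Fin M ≃ Fin n)
variable (JV : Matrix (Fin N) (Fin N) E) (JW : Matrix (Fin M) (Fin M) E)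
variable {TV : Matrix (Fin N) (Fin N) F} {TW : Matrix (Fin M) (Fin M) F}

/-- **The pair map** `U(J_V)(𝔸) × U(J_W)(𝔸) →* U(J_V ⊗ J_W)(𝔸)`, `(x, y) ↦ (x ⊗ 1)(1 ⊗ y)` (the map along which
`pairSplitting s = s ∘ pairMap`). [folklore] -/
def pairMap : UnitaryGroup.adelic F E c N JV × UnitaryGroup.adelic F E c M JW →* UnitaryGroup.adelicPair F E c N M JV JW :=
  MonoidHom.noncommCoprod (UnitaryGroup.adelicInl F E c N M JV JW) (UnitaryGroup.adelicInr F E c N M JV JW)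
    (UnitaryGroup.commute_adelicInl_adelicInr F E c N M JV JW)

omit [NumberField F] in
/-- formula. [folklore] -/
theorem pairMap_apply (p : UnitaryGroup.adelic F E c N JV × UnitaryGroup.adelic F E c M JW) :
    pairMap F E c N M JV JW p =
      UnitaryGroup.adelicInl F E c N M JV JW p.1 * UnitaryGroup.adelicInr F E c N M JV JW p.2 := rfl

/-- `pairSplitting s = s ∘ pairMap`. [folklore] -/
theorem pairSplitting_eq_comp_pairMap
    (s : UnitaryGroup.adelicPair F E c N M JV JW →* adelicMpCont F (Fin n) (adelicGram F e TV TW)) :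
    pairSplitting F E c N M e JV JW s = s.comp (pairMap F E c N M JV JW) := rfl

set_option maxHeartbeats 800000 in
/-- **`(s ⊗ η)_pair (p) = η(pairMap p) · s_pair (p)`**. [folklore] -/
theorem pairSplitting_twist_apply
    (s : UnitaryGroup.adelicPair F E c N M JV JW →* adelicMpCont F (Fin n) (adelicGram F e TV TW))
    (η : UnitaryGroup.adelicPair F E c N M JV JW →* ℂˣ)
    (p : UnitaryGroup.adelic F E c N JV × UnitaryGroup.adelic F E c M JW) :
    pairSplitting F E c N M e JV JW (adelicMpCont.twist F (Fin n) (adelicGram F e TV TW) s η) p =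
      adelicMpCont.ofScalar F (Fin n) (adelicGram F e TV TW) (η (pairMap F E c N M JV JW p)) *
        pairSplitting F E c N M e JV JW s p := rfl

set_option maxHeartbeats 800000 in
/-- **`(s ⊗ η)_pair = s_pair ⊗ (η ∘ pairMap)`**. [folklore] -/
theorem pairSplitting_twist
    (s : UnitaryGroup.adelicPair F E c N M JV JW →* adelicMpCont F (Fin n) (adelicGram F e TV TW))
    (η : UnitaryGroup.adelicPair F E c N M JV JW →* ℂˣ) :
    pairSplitting F E c N M e JV JW (adelicMpCont.twist F (Fin n) (adelicGram F e TV TW) s η) =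
      adelicMpCont.twist F (Fin n) (adelicGram F e TV TW) (pairSplitting F E c N M e JV JW s)
        (η.comp (pairMap F E c N M JV JW)) :=
  MonoidHom.ext fun _ => rfl

/-- **`(ω_ψ ∘ (s ⊗ η)_pair)(p) Φ = η(pairMap p) • (ω_ψ ∘ s_pair)(p) Φ`**. [folklore] -/
theorem pairRep_twist_apply
    (s : UnitaryGroup.adelicPair F E c N M JV JW →* adelicMpCont F (Fin n) (adelicGram F e TV TW))
    (η : UnitaryGroup.adelicPair F E c N M JV JW →* ℂˣ)
    (p : UnitaryGroup.adelic F E c N JV × UnitaryGroup.adelic F E c M JW) (Φ : piSchwartzBruhat F (Fin n)) :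
    pairRep F E c N M e JV JW (adelicMpCont.twist F (Fin n) (adelicGram F e TV TW) s η) p Φ =
      ((η (pairMap F E c N M JV JW p) : ℂˣ) : ℂ) • pairRep F E c N M e JV JW s p Φ := rfl

/-- The same with the scalar written through the character `η ∘ pairMap` of the product group (the shape
`h : ∀ g v, ρ′ g v = (c g : ℂ) • ρ g v` consumed by `UnitaryGroup.kappaIsotypic_smul_twist`). [folklore] -/
theorem pairRep_twist_apply'
    (s : UnitaryGroup.adelicPair F E c N M JV JW →* adelicMpCont F (Fin n) (adelicGram F e TV TW))
    (η : UnitaryGroup.adelicPair F E c N M JV JW →* ℂˣ)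
    (p : UnitaryGroup.adelic F E c N JV × UnitaryGroup.adelic F E c M JW) (Φ : piSchwartzBruhat F (Fin n)) :
    pairRep F E c N M e JV JW (adelicMpCont.twist F (Fin n) (adelicGram F e TV TW) s η) p Φ =
      ((η.comp (pairMap F E c N M JV JW) p : ℂˣ) : ℂ) • pairRep F E c N M e JV JW s p Φ := rfl

/-- `(s ⊗ η)_pair` is continuous when `s` and `η` are. [folklore] -/
theorem continuous_pairSplitting_twist
    {s : UnitaryGroup.adelicPair F E c N M JV JW →* adelicMpCont F (Fin n) (adelicGram F e TV TW)}
    {η : UnitaryGroup.adelicPair F E c N M JV JW →* ℂˣ} (hsc : Continuous s)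
    (hη : Continuous fun g => ((η g : ℂˣ) : ℂ)) :
    Continuous (pairSplitting F E c N M e JV JW (adelicMpCont.twist F (Fin n) (adelicGram F e TV TW) s η)) :=
  continuous_pairSplitting F E c N M e JV JW (adelicMpCont.continuous_twist s η hsc hη)

variable [Algebra.IsQuadraticExtension F E] {δ : E} (hcδ : c δ = -δ) (hδ : δ ≠ 0) {d : F}
  (hd : δ * δ = algebraMap F E d) (hV : TV.IsSymm) (hW : TW.IsSymm) (hVd : IsUnit TV.det) (hWd : IsUnit TW.det)
  (hJV : JV = TV.map (algebraMap F E)) (hJW : JW = TW.map (algebraMap F E))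

/-- **A normalised compatible splitting is compatible** ([GelbartRogawski1991, Remark p. 457], "if" direction,
for the unitary dual pair): if `s` is compatible and `η` is trivial on the rational points `U(J_V ⊗ J_W)(F)`, then
`s ⊗ η` is compatible. [cite: GelbartRogawski1991, §3.1 Remark p. 457 L4–13] -/
theorem isCompatible_twist
    {s : UnitaryGroup.adelicPair F E c N M JV JW →* adelicMpCont F (Fin n) (adelicGram F e TV TW)}
    (hs : (splittingDatum F E c N M e JV JW hcδ hδ hd hV hW hVd hWd hJV hJW).IsCompatible s)
    {η : UnitaryGroup.adelicPair F E c N M JV JW →* ℂˣ}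
    (hη : ∀ γ ∈ (splittingDatum F E c N M e JV JW hcδ hδ hd hV hW hVd hWd hJV hJW).ratPts, η γ = 1) :
    (splittingDatum F E c N M e JV JW hcδ hδ hd hV hW hVd hWd hJV hJW).IsCompatible
      (adelicMpCont.twist F (Fin n) (adelicGram F e TV TW) s η) :=
  hs.of_central_twist (fun g => adelicMpCont.ofScalar F (Fin n) (adelicGram F e TV TW) (η g))
    (fun g => adelicMpCont.proj_ofScalar (η g))
    (fun g => adelicMpCont.twist_apply s η g)
    (fun γ hγ => (congrArg (adelicMpCont.ofScalar F (Fin n) (adelicGram F e TV TW)) (hη γ hγ)).trans (map_one _))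

/-- Consequently `π ∘ (s ⊗ η)_pair = ι ∘ pairMap`. [folklore] -/
theorem proj_pairSplitting_twist
    {s : UnitaryGroup.adelicPair F E c N M JV JW →* adelicMpCont F (Fin n) (adelicGram F e TV TW)}
    (hs : (splittingDatum F E c N M e JV JW hcδ hδ hd hV hW hVd hWd hJV hJW).IsCompatible s)
    {η : UnitaryGroup.adelicPair F E c N M JV JW →* ℂˣ}
    (hη : ∀ γ ∈ (splittingDatum F E c N M e JV JW hcδ hδ hd hV hW hVd hWd hJV hJW).ratPts, η γ = 1)
    (p : UnitaryGroup.adelic F E c N JV × UnitaryGroup.adelic F E c M JW) :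
    adelicMpCont.proj F (Fin n) (adelicGram F e TV TW)
        (pairSplitting F E c N M e JV JW (adelicMpCont.twist F (Fin n) (adelicGram F e TV TW) s η) p) =
      toSp F E c N M e JV JW hcδ hδ hd hV hW hJV hJW
        (UnitaryGroup.adelicInl F E c N M JV JW p.1 * UnitaryGroup.adelicInr F E c N M JV JW p.2) :=
  proj_pairSplitting F E c N M e JV JW hcδ hδ hd hV hW hVd hWd hJV hJW (isCompatible_twist F E c N M e JV JW
    hcδ hδ hd hV hW hVd hWd hJV hJW hs hη) p

/-- … and `ω_ψ((s ⊗ η)_pair(γ_U, γ))` fixes the theta distribution for rational `γ_U`, `γ`. [folklore] -/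
theorem pairRep_twist_toHomUnits_mem_thetaStabilizer
    {s : UnitaryGroup.adelicPair F E c N M JV JW →* adelicMpCont F (Fin n) (adelicGram F e TV TW)}
    (hs : (splittingDatum F E c N M e JV JW hcδ hδ hd hV hW hVd hWd hJV hJW).IsCompatible s)
    {η : UnitaryGroup.adelicPair F E c N M JV JW →* ℂˣ}
    (hη : ∀ γ ∈ (splittingDatum F E c N M e JV JW hcδ hδ hd hV hW hVd hWd hJV hJW).ratPts, η γ = 1)
    {γU : UnitaryGroup.adelic F E c N JV} (hγU : γU ∈ (UnitaryGroup.toAdelic F E c N JV).range)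
    {γ : UnitaryGroup.adelic F E c M JW} (hγ : γ ∈ (UnitaryGroup.toAdelic F E c M JW).range) :
    (pairRep F E c N M e JV JW (adelicMpCont.twist F (Fin n) (adelicGram F e TV TW) s η)).toHomUnits (γU, γ) ∈
      thetaStabilizer F (Fin n) :=
  pairRep_toHomUnits_mem_thetaStabilizer F E c N M e JV JW hcδ hδ hd hV hW hVd hWd hJV hJW
    (isCompatible_twist F E c N M e JV JW hcδ hδ hd hV hW hVd hWd hJV hJW hs hη) hγU hγ

/-! ### Build-lane note (ops-buildfix G11b-3 recipe, LEDGER B13-1, 2026-08-21)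
`lean -o` (the hub build lane, never `lean`/the gate check) runs Lean 4.32's library-suggestion indexers
(`Lean.LibrarySuggestions.SymbolFrequency` / `SineQuaNon`, from their `exportEntriesFn`) over the statement of
every local theorem that is not a denied premise; on this family's statements (very large dependent binder
telescopes through the theta-kernel / dual-pair data) that fold runs for tens of minutes to hours and the build
lane kills the job (incident G11b-3, run/shared/lean/ops/buildfix/G11b-3-DOSSIER.md). `isDeniedPremise` skips
`[implicit_reducible]` constants before any fold, and a reducibility status on a *theorem* is inert (Meta never
unfolds `thmInfo`; the kernel ignores the attribute), so the public theorems of this file are tagged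
`[implicit_reducible]` purely to keep them out of that index. Only other effect: they are not offered by
`+suggestions` premise selectors. No statement or proof is changed; superseded if the operator lands a
deny-list form (`HarnessLib.PremiseIndex`). -/
set_option allowUnsafeReducibility true in
attribute [implicit_reducible]
  pairMap_apply pairSplitting_eq_comp_pairMap pairSplitting_twist_apply pairSplitting_twist
  pairRep_twist_apply pairRep_twist_apply' continuous_pairSplitting_twist isCompatible_twist
  proj_pairSplitting_twist pairRep_twist_toHomUnits_mem_thetaStabilizer

end UnitaryDualPair

end Literature.NumberTheory.GelbartRogawski1991

end
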